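import Mathlib
import HarnessLib
import HarnessLib.Audit
import Summits.FinalStateConjecture.Statement
import Literature.Geometry.Lorentzian.TrappedSurface
import Literature.Geometry.Lorentzian.QuasiFinalStateDecomposition
import HarnessLib.Audit.Status.Attr

/-!
Route: RootDecompTrappedGauge

# Route RootDecompTrappedGauge — Root decomposition N2d «TrappedGauge» (form b2) — CausalCells top
level by signature; trapped cell cut by SLICE-GAUGE SATURATION: trapped on arrival ∧ cure descent
along the orbit ∧ hidden trapping

DECOMPOSITION CELL decomp-fsc (D-0178; doctrine D-0170/0171/0172), summit S =
`_root_.FinalStateConjecture` exactly as typed; LADDER rung 0 — NOTHING IN THIS FILE PROVES THE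
FINAL STATE CONJECTURE. THIN OR-SIBLING in FILING FORM (b2) (critic CLEARED 2026-08-30T04:33:34Z for
lens-4 g6 «TrappedGaugeSaturation»; standing rules 03:00:14Z / 03:45:00Z) of
Theses/RootDecompCausalCells.lean (route-FinalStateConjecture-RootDecompCausalCells, node N2): this
file = node N2d «TrappedGauge». The route is BORN with its top level BY SIGNATURE only — TrappedExit
= stmt-24764, ExtremalThresholdExit = 24765, DispersiveExit = 24766, NakedThresholdExit = 24767 —
and `closes` over exactly these four is RootDecompCausalCells' `closes` verbatim
(folder/n2e/glue.lean = folder/n2/glue.lean, kernel-checked rc 0); the lens-4 g6 cut is then filed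
ON THIS ROUTE as the GLUED SPLIT of TrappedExit (`--split TrappedExit --into InitiallyTrappedExit
TrappedGaugeDescent SliceHiddenTrappedExit --glue 'InitiallyTrappedExit → TrappedGaugeDescent →
SliceHiddenTrappedExit → TrappedExit'`), because TrappedExit already carries an active split on its
home route (TrappedWild ∧ PerturbativeCell) and a by-signature cut on RootDecompTrappedBasinCells
(Cens / P_w⁰): this is the THIRD partition of 𝓣, admitted by the critic as an OR-alternative because
it is a NORMAL FORM («no fourth partition of 𝓣 will be cleared without retiring one»). THE MOVE (the
lens's reduction theorem, new on this summit): minimal counterexample modulo the compactly supported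
Cauchy-SLICE GAUGE inside its own MGHD — Gauge d d′ :≡ MGHDs time-orientedly isometric by ψ with ψ ∘
ι = ι′ off a compact K ⊆ X (d, d′ = induced data of two Cauchy slices of ONE vacuum spacetime, equal
outside a compact set); the saturating predicate TrapD d := the datum carries an embedded spacelike
2-sphere with θ⁺ = tr_S k + H < 0 and θ⁻ = tr_S k − H < 0 (Andersson–Mars–Simon Def. 1;
outer/innerNullExpansionInData; PDE-free, orientation-free), gauge-FRAGILE (Wald–Iyer 1991: Kruskal
slicings with no trapped surface on any slice), GTrapD d := some gauge relative is TrapD. Pieces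
(exact: TrappedExit ⟺ A ∧ R ∧ Z, two excluded middles on GTrapD d / TrapD d): A =
InitiallyTrappedExit (𝓣 ∧ TrapD: trapped ON ARRIVAL, curable — NEW RESIDUAL, silent on late trappers
such as Christodoulou 2008 short-pulse data and Wald–Iyer slices; INSTRUMENTABLE: membership
PDE-free, census asks K6a/K6b; INTERNAL NODE, parked unless a next cut names a norm-matched rung;
print-dominated by lens-1's AH cells mod Andersson–Metzger / Eichmair — remark, no double filing), R
= TrappedGaugeDescent (𝓣 ∧ ¬TrapD ∧ GTrapD: a late trapper is curable if its trapped-on-arrival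
gauge relatives are curable-if-exceptional — formally WEAKER (S-implied), COUNTS, ATTACKABLE NOW:
lens kernel trappedGaugeDescent_of_stubs : GaugeInvariance → CureDescent → R with R1 =
Choquet-Bruhat–Geroch uniqueness + re-anchoring of P_Σ's asymptotic clauses at the deformed slice +
θ±(data) = θ±(spacetime), R2 = Cauchy stability WITH PARAMETERS on the compact lens region, both
∀-data, NOT S-implied ⇒ stubs, never binders; norm-matched — compact region, AF end untouched,
caution c4 does not bite; outside all catalogued barrier families), Z = SliceHiddenTrappedExit (𝓣 ∧
¬GTrapD — thin, conjecturally VACUOUS via Z1 NoHiddenTrapping: achronal closed trapped sphere +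
Bernal–Sánchez gr-qc/0512095 Thm 1.1; not printed ⇒ not decorative today; candidate aside). Normal
form (lens kernel trappedExit_iff_initiallyTrapped_of_lemmas): R1 ∧ R2 ∧ Z1 ⟹ (TrappedExit ↔
InitiallyTrappedExit). DOMINATION POINTER: «24764 ⟺ A ∧ R ∧ Z; attack R (porting) / A, NOT 24764».
STATEMENT-AUDIT PROBE requested by the critic (T12): is the typed P_Σ invariant under a compactly
supported SliceGauge (expected yes; a no is an audit finding against the Statement's typing, not
against this node). The whole AND/OR tree is kept in HOME/TREE.md (HOME =
run/shared/lean/pub/decomp-fsc).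
Lean: `TrappedExit ∧ ExtremalThresholdExit ∧ DispersiveExit ∧ NakedThresholdExit` (the four
by-signature decls of this file; `closes` in folder/n2e/glue.lean; the lens-4 g6 pieces enter as the
glued split of TrappedExit)

## Assembly
Pure logic inside `closes` (folder/n2e/glue.lean = RootDecompCausalCells' closes verbatim, 0 sorry;
kernel-checked in folder/n2e/Sketch.lean together with the children and the glue
`trappedExit_of_pieces` by two nested excluded middles): dispersive / trapped / threshold-by-P_w
case analysis; the cure «∀ c ≠ 0, P_Σ (F c)» repackaged as «F c ∉ {d ∈ 𝓓 | ¬P d}». Binders consumed: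
all four (cone 4).

Rationale: WHY THIS LINE. Population splits of the exceptional set with cure target P are free and exact
(critic `fsc_iff_cellSplit`; tame genericity is monotone but not ∧-closed, tree
`isTameChristodoulouGeneric_and_fails`, so no clause is split off), hence judged on content: the
cells here are three DIFFERENT open programmes with disjoint toolkits — (𝓒) rigidity / no-breather
theorems for complete vacuum spacetimes (Lichnerowicz, Anderson doi:10.1007/PL00001021,
Alexakis–Schlue arXiv:1504.04592; Luk–Oh arXiv:2108.13379 Thm 1.3 gives openness of dispersion only
among decaying solutions), (𝓣) capture + black-hole stability + rigidity of the stationary end state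
(KlainermanSzeftel2020, Klainerman2025, Hintz2026 = arXiv:2606.28253 CLAIM for |a| < M), (𝓝) weak
cosmic censorship and the third law / extremal critical collapse (Christodoulou1999;
arXiv:1912.08478; arXiv:2211.15742, arXiv:2402.10190) — so difficulty is DISTRIBUTED and the two
registered hard cores are separated by the cut (capture/rigidity in 𝓣, censorship of untrapped naked
data in 𝓝 ∧ ¬P_w). Penrose's incompleteness theorem (doi:10.1103/PhysRevLett.14.57) is the structure
lemma making 𝓒 and 𝓣 disjoint but is not needed for exactness (excluded middle). Imported from
outside GR: nothing; the threshold picture is calibrated on the charged model (Kehle–Unger: critical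
set = codimension-one hypersurface B_crit met transversally). What it does that prior routes do not
(census RT2): the sector routes split all data by completeness and carry pointwise «complete ⇒
disperse» pieces not implied by S; this node restricts every piece to exceptional data (all four
S-implied in the kernel) and adds the extremality layer on the threshold.

RANKED CRUXES. #2 TrappedExit (crux) — = the BORN item stmt-FinalStateConjecture-24764 of
route-FinalStateConjecture-RootDecompCausalCells (node N2), reused BY SIGNATURE (dedup-attach);
INTERNAL NODE — on its home route it carries the active split TrappedWild ∧ PerturbativeCell (rev 1)
and the thin sibling RootDecompTrappedBasinCells cuts it by Cens / P_w⁰; HERE it receives,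
immediately after birth, the critic-CLEARED (2026-08-30T04:33:34Z) lens-4 g6 ALTERNATIVE cut
«TrappedGaugeSaturation» as its glued split on THIS route (one active decomposition per node per
route; D-0019: an alternative decomposition of the same statement is a separate route sharing the
decl): InitiallyTrappedExit ∧ TrappedGaugeDescent ∧ SliceHiddenTrappedExit, exact by two excluded
middles on GTrapD d / TrapD d (lens kernel split_iff BY NAME @43d49062); text as born: PIECE 𝓣 —
TrappedExit [WEAKER·COUNTS — critic CLEARED 2026-08-30T01:39:13Z; INTERNAL NODE queued for gen 1
(capture + WCC-after-trapping + rigidity + third-law-after-trapping + N ≤ 2); leaf IDEA-NEEDED +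
INSTRUMENTABLE (falsification: NR remnant spins |a_f|/M_f bounded away from 1 on open sets of
trapped data); hard cores stmt-17308, stmt-10745 inside; near-Kerr sub-population print-adjacent
(SlowlyRotatingKerrFrontier; arXiv:2606.28253 CLAIM) deliberately not split off]. For every Σ and
every admissible P_Σ-exceptional datum d which is NOT of dispersive type and all of whose MGHDs
contain a closed trapped sphere (IsTrappedSurface, both null expansions negative) in the causal
future of the data, there are one asymptotically flat end e and a tame (order 1 at e),
immersed-at-0, injective one-parameter family F of admissible data with F 0 = d all of whose members
c ≠ 0 satisfy P_Σ. [difficulty: open-problem] (why it might fail: an open (wDist-tame) set of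
trapped admissible data whose exteriors keep non-decaying hair, radiate forever, or settle to a
non-Kerr / exactly extremal stationary state; capture may fail for rapidly rotating collapse (|a| →
M, Aretakis).) [arXiv:2606.28253, KlainermanSzeftel2020, Klainerman2025, arXiv:2211.15742,
doi:10.1103/PhysRevLett.14.57]
#3 ExtremalThresholdExit (crux) — = the BORN item stmt-FinalStateConjecture-24765 of
route-FinalStateConjecture-RootDecompCausalCells (node N2), reused BY SIGNATURE (dedup-attach); text
as born: PIECE 𝓝∧P_w — ExtremalThresholdExit [WEAKER·thin — critic CLEARED 2026-08-30T01:39:13Z with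
retag: the printed Kehle–Unger exit family (arXiv:2402.10190 Thm 1, Einstein–Maxwell–Vlasov) is a
MODEL-ANALOGUE, not a rung; leaf IDEA-NEEDED; BARRIER placement: AretakisInstability concerns
settling ON the threshold, this piece only asks to LEAVE it along a tame curve — outside; the bet is
transversality of B_crit]. For every Σ and every admissible P_Σ-exceptional datum d of threshold
type (not dispersive, not trapped) which satisfies the WEAK property P_w (an MGHD exists; every MGHD
has complete 𝓘⁺ and a Kerr final state decomposition with all the Statement's clauses but only |aᵢ|
≤ Mᵢ — so d fails P_Σ only through an exactly extremal final hole), there are one end e and a tame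
immersed injective one-parameter family F of admissible data with F 0 = d whose members c ≠ 0
satisfy P_Σ. [difficulty: open-problem] (why it might fail: the extremal critical set B_crit could
be thick in the tame topology (extremal thresholds accumulating on themselves along every tame
line), or leaving the threshold could land in naked data; vacuum extremal formation itself is open
(arXiv:2402.10190 p.12).) [arXiv:2402.10190, arXiv:2211.15742, arXiv:2304.08455]
#4 DispersiveExit (crux) — = the BORN item stmt-FinalStateConjecture-24766 of
route-FinalStateConjecture-RootDecompCausalCells (node N2), reused BY SIGNATURE (dedup-attach); text
as born: PIECE 𝓒 — DispersiveExit [WEAKER·thin — critic CLEARED 2026-08-30T01:39:13Z; implied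
outright by the registered pointwise item stmt-FinalStateConjecture-17320
`NoParkingWithoutHorizon.CompleteSpacetimesDisperse` (lens kernel
`dispersiveExit_of_completeSpacetimesDisperse`; cited by name, not re-typed); leaf IDEA-NEEDED;
attackable-now sub-rung: stationary-complete ⇒ flat (Lichnerowicz–Anderson port); rung stmt-10029
NoVacuumBreathers]. For every Σ and every admissible P_Σ-exceptional datum d of dispersive type (an
MGHD exists and every MGHD is future causally geodesically complete: no future null or timelike
geodesic incompleteness, stated under the metric's Levi-Civita instance), there are one end e and a
tame immersed injective one-parameter family F of admissible data with F 0 = d whose members c ≠ 0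
satisfy P_Σ. [difficulty: open-problem] (why it might fail: a non-radiating vacuum breather or a
complete development with curvature not decaying at i⁺ whose tame neighbours are also exceptional
(an open set) refutes it; no-breather results hold only near 𝓘 (arXiv:1504.04592) or for decaying
solutions (arXiv:2108.13379).) [arXiv:2108.13379, arXiv:1504.04592, doi:10.1007/PL00001021]
#5 NakedThresholdExit (crux) — = the BORN item stmt-FinalStateConjecture-24767 of
route-FinalStateConjecture-RootDecompCausalCells (node N2), reused BY SIGNATURE (dedup-attach); text
as born: PIECE 𝓝∧¬P_w — NakedThresholdExit [WEAKER·COUNTS — critic CLEARED 2026-08-30T01:39:13Z; =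
weak cosmic censorship on the untrapped incomplete sector in Christodoulou's own codimension form
(the all-cells version is the registered hard core stmt-FinalStateConjecture-17269, cited; this is
its cell restriction with cure target P_Σ); leaf IDEA-NEEDED; BARRIER: nakedSingularityInstability
is the MODEL exit family (Christodoulou1999 Thm 4.1, 2-plane of exits) = the generic form, outside
the genericity-blind class; functional-framework dependence (Singh–Zheng arXiv:2605.16235:
Hölder-stable naked singularities in the spherical scalar field) — the bet is that smooth tame data
are on the unstable side]. For every Σ and every admissible P_Σ-exceptional datum d of threshold
type (not dispersive, not trapped) failing even the weak property P_w (no MGHD, or an MGHD with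
incomplete 𝓘⁺, or censored but settling to no Kerr configuration with |aᵢ| ≤ Mᵢ), there are one end
e and a tame immersed injective one-parameter family F of admissible data with F 0 = d whose members
c ≠ 0 satisfy P_Σ. [difficulty: open-problem] (why it might fail: a smooth-data analogue of the
Singh–Zheng stability — a tame-open set of admissible vacuum data forming naked singularities (RSR
arXiv:1912.08478 exteriors are fine-tuned, consistent so far).) [Christodoulou1999,
arXiv:1912.08478, arXiv:2204.09891, arXiv:2605.16235, arXiv:0811.0354]

TWO-LAYER PLAN. Layer 2 here = {InitiallyTrappedExit, TrappedGaugeDescent, SliceHiddenTrappedExit}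
under TrappedExit (filed as the glued split right after birth; glue item provable now by the lens
proof). Foreseen, NOT filed: beneath R the two ∀-data stubs R1 GaugeInvariance / R2 CureDescent
(typed in the lens kernel as defs; a prover attaches them with --supports, never as items: D-0019
two layers); beneath Z the stub Z1 NoHiddenTrapping; beneath A nothing until a next cut names a
norm-matched rung (PARK RULE 03:28:43Z) — the critic records that A's population carries an
outermost MOTS (Andersson–Metzger arXiv:0708.4252 / Eichmair), so A overlaps lens-1's AH-typed cells
26560 / 27211 (different parents, different lets; re-use of let TrapD BY NAME if ever needed, no
double filing).

KILL CRITERIA. All binders and all three split children are S-implied in the kernel (lens *_of_fsc),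
so a refutation of any of them — a tame-open set of exceptional data inside one cell: tame-stable
trapped-on-arrival data with eternal non-Kerr hair or drifting to extremality (A), a late trapper
whose trapped-on-arrival gauge relatives are all curable while it is not (R — would contradict
Cauchy stability with parameters, i.e. expose a typing defect of P_Σ), a tame-stable family of
developments whose trapped spheres are all non-achronal (Z) — refutes the summit AS TYPED and closes
this route `refuted:<Decl>`; it feeds the statement audit (critic probe T12: SliceGauge-invariance
of the typed P_Σ), not a pivot. Mooted piecewise: R closes when R1 + R2 are ported; Z closes when Z1
NoHiddenTrapping is proved; all three are mooted by a direct proof of 24764 on CausalCells or of the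
𝓣-cells of TrappedBasinCells. Superseded if the critic retires this partition of 𝓣 in favour of
another (at most three partitions of 𝓣 stand).

NOT DECOMPOSED YET. InitiallyTrappedExit's interior (large data behind an apparent horizon:
censorship after trapping, capture, rigidity, third law) is famous-grade and deliberately not
decomposed; R1/R2/Z1 are typed stubs inside the lens kernel, not items; Penrose's theorem is
descriptive only; constants never enter binders.

CHEAPEST FALSIFIER. TrappedGaugeDescent: the critic's statement-audit probe T12 — a kernel attempt
at «SliceGauge d d′ → (P_Σ d ↔ P_Σ d′)» for the TYPED P_Σ (exteriorOf / RaysStayInClosure /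
sojourn-complete 𝓘⁺ anchored at ι(Σ)); expected provable (J⁺ changes by a precompact set only); a
failure kills R as typed and is an audit finding against the Statement. SliceHiddenTrappedExit: a
printed development all of whose closed trapped spheres are non-achronal (none known: Kruskal and
all collapse models have trapped spheres on slices). InitiallyTrappedExit: an NR/PN catalogue entry
of trapped-on-arrival vacuum data with remnant |a_f|/M_f → 1 or permanent hair on an OPEN set (none:
SXS arXiv:1904.04831 remnants ≤ 0.95). The route itself dies cheaply if the by-signature attach of
any of its four items is refused (fallback b1: flat cone A, R, Z + three by signature, closes₆ =
lens g6/glue.lean).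

NUMBERS. Print only: binary-merger remnants |a_f|/M_f ≲ 0.95 (SXS catalogue arXiv:1904.04831);
vacuum gluing produces extremal-horizon formation only for |a|/M ≤ a₀ ≪ 1 so far (arXiv:2304.08455);
Choptuik-type threshold scaling in the charged model (arXiv:2402.10190). No constant enters a
binder.

DEFINITION REQUESTS. None new. R1 GaugeInvariance, R2 CureDescent, Z1 NoHiddenTrapping are typed as
Props in the lens kernel (decomp-fsc-lens-4/g6/TrappedGaugeSaturation.lean) over existing
declarations; the cell's pending requests D1–D4 (defn-ConeSeedData, wi-96534/96535/96536; D4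
charWeightedEDist to be relayed) concern the fate-side residuals, not this cut.

Novelty: GEN-6 (2026-08-30T04:31Z, lens-4 g6 + critic 04:33:34Z + writer): the move = saturate a cell of the
exceptional set by the compactly supported SLICE-GAUGE groupoid of its own MGHD and split off the
cure-descent statement as a theorem-grade piece (normal form «WLOG trapped on arrival»); nearest
in-tree = lens-6's dilation saturation QS on N5c (same abstract saturation_split, different —
finite-dimensional — orbit), lens-5 g4's future-slice census (slices as a counting device, no cure
transport), lens-1's AH cells on the GIVEN slice (A is print-dominated by them mod Andersson–Metzger
/ Eichmair). Searches (lens-4, 2026-08-30, labelled in decomp-fsc-lens-4/NOTES.md): lit search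
--hybrid ×3 («trapped surface slicing dependence Wald Iyer», «Cauchy stability Einstein equations
parameters compact region», «Cauchy hypersurface through compact spacelike submanifold Bernal
Sánchez») → [corpus:book:hawking1973-large-scale-structure-space-time pp.247–250] + arXiv hits; lit
vsearch ×1; lit galaxy search "Wald-Iyer|trapped surfaces|Cauchy stability" --star all →
[galaxy:pdf:-1249461259232425900] (Dotti arXiv:2308.13950 p.2); null for the move: no hit for
«genericity / cures of Cauchy data transported between slices of one development» in corpus
(fts+vec) or galaxy. Nearest prior art: Wald–Iyer doi:10.1103/PhysRevD.44.R3719; Dotti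
arXiv:2308.13950; Bernal–Sánchez arXiv:gr-qc/0512095 Thm 1.1; Hawking–Ellis §7.5;
Choquet-Bruhat–Geroch doi:10.1007/BF01645389. Delta in one sentence: slicing-fra  [refs: 10.1103/PhysRevD.44.R3719, 10.1007/BF01645389., 10.1103/PhysRevLett.14.57, 2308.13950, gr-qc/0512095, 2402.10190, book:hawking1973-large-scale-structure-space-time, doi:10.1103/PhysRevD.44.R3719, doi:10.1007/BF01645389., arxiv-2402.10190, arxiv-2108.13379, arxiv-1504.04592, arxiv-2605.16235, arxiv-2606.28253, doi:10.1103/PhysRevLett.14.57]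

Barriers (technique_class: population-split, gauge-saturation, normal-form): - technique_class: population-split, gauge-saturation, normal-form
- Literature.Barriers.FinalStateConjecture.nakedSingularityInstability: genericity-blind methods
excluded; NakedThresholdExit / all pieces are the GENERIC (tame-curve) forms — outside the class;
the barrier's own theorem (Christodoulou 1999 Thm 4.1) is the model exit family.
- Literature.Barriers.FinalStateConjecture.AretakisInstability: bites settling ON an extremal
horizon and every uniform-in-spin road inside TrappedExit; ExtremalThresholdExit only asks to LEAVE
the threshold along a tame curve — outside; inside TrappedExit it is declared (third law after
trapping), not evaded.
- Literature.Barriers.FinalStateConjecture.SlowlyRotatingKerrFrontier: printed near-Kerr basins are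
NOT split off as a cell (a theorem-cell would be decorative); TrappedExit's closing as typed needs
the full range — inside the frontier's shadow for roads, acknowledged.
- Literature.Barriers.FinalStateConjecture.KerrSuperradiance: decay-estimate barrier for linear
roads inside TrappedExit; the binders are data-side exit statements — outside for the statements,
inside for every decay road (DRSR currents needed).
- Literature.Barriers.FinalStateConjecture.SbierskiTrappingObstruction: derivative loss at trapping;
no decay rate is typed in any item — outside for statements, inside for decay roads.
- Literature.Barriers.FinalStateConjecture.PriceLawTail: polynomial tails forbid exponential-rate
transplants; no rate typed — outside.
- Liter

sub-problem: FinalStateConjecture · status: draft · opened planner-decomp-fsc-writer-1-g0-0 2026-08-30T04:34:57Z · rev 2 · ledger route-FinalStateConjecture-RootDecompTrappedGauge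
GENERATED by the gate from the ledger (D-0016/17). Provers cite these decls: `theorem foo : Summit.FinalStateConjecture.FinalStateConjecture.Theses.RootDecompTrappedGauge.<Decl> := …` in Summits/FinalStateConjecture/FinalStateConjecture/Theorems/<Name>.lean.
-/

namespace Summit.FinalStateConjecture.FinalStateConjecture.Theses.RootDecompTrappedGauge

open scoped BigOperators Topology Manifold Classical MeasureTheory ProbabilityTheory Matrix InnerProductSpace ComplexConjugate ContinuousMap
open Filter Set Function TopologicalSpace MeasureTheory

attribute [summit_statement] _root_.FinalStateConjecture

/-- item stmt-FinalStateConjecture-24764 · crux · rank 2 · SPLIT (gen 2) into InitiallyTrappedExitR, TrappedGaugeDescentR, SliceHiddenTrappedExitR + glue TrappedExitGlueR · direct attempts still welcome (low priority) · by planner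
why it might fail: an open (wDist-tame) set of trapped admissible data whose exteriors keep non-decaying hair, radiate forever, or settle to a non-Kerr / exactly extremal stationary state; capture may fail for rapidly rotating collapse (|a| → M, Aretakis).
sources: arXiv:2606.28253, KlainermanSzeftel2020, Klainerman2025, arXiv:2211.15742, doi:10.1103/PhysRevLett.14.57
earlier split gen 1: InitiallyTrappedExit, TrappedGaugeDescent, SliceHiddenTrappedExit — retired stmt-FinalStateConjecture-27941, stmt-FinalStateConjecture-27942, stmt-FinalStateConjecture-27943, stmt-FinalStateConjecture-27944
retired/moot children: InitiallyTrappedExit [retired: ∀ (X : Type) [TopologicalSpace X] [ChartedSpace Literature.Geometry.Lorentzian.E]; TrappedGaugeDescent [retired: ∀ (X : Type) [TopologicalSpace X] [ChartedSpace Literature.Geometry.Lorentzian.E]; SliceHiddenTrappedExit [retired: ∀ (X : Type) [TopologicalSpace X] [ChartedSpace Literature.Geometry.Lorentzian.E]; TrappedExitGlue [retired: InitiallyTrappedExit → TrappedGaugeDescent → SliceHiddenTrappedExit → TrappedExi]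
[crux] PIECE 𝓣 — TrappedExit [WEAKER·COUNTS — critic CLEARED 2026-08-30T01:39:13Z; INTERNAL NODE
queued for gen 1 (capture + WCC-after-trapping + rigidity + third-law-after-trapping + N ≤ 2); leaf
IDEA-NEEDED + INSTRUMENTABLE (falsification: NR remnant spins |a_f|/M_f bounded away from 1 on open
sets of trapped data); hard cores stmt-17308, stmt-10745 inside; near-Kerr sub-population
print-adjacent (SlowlyRotatingKerrFrontier; arXiv:2606.28253 CLAIM) deliberately not split off]. For
every Σ and every admissible P_Σ-exceptional datum d which is NOT of dispersive type and all of
whose MGHDs contain a closed trapped sphere (IsTrappedSurface, both null expansions negative) in the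
causal future of the data, there are one asymptotically flat end e and a tame (order 1 at e),
immersed-at-0, injective one-parameter family F of admissible data with F 0 = d all of whose members
c ≠ 0 satisfy P_Σ. [difficulty: open-problem] -/
@[route_item "route-FinalStateConjecture-RootDecompTrappedGauge", crux]
def TrappedExit : Prop :=
  ∀ (X : Type) [TopologicalSpace X] [ChartedSpace Literature.Geometry.Lorentzian.E3 X] [IsManifold (𝓡 3) ((⊤ : ℕ∞) : WithTop ℕ∞) X] [T2Space X] [SecondCountableTopology X] [ConnectedSpace X], let P : Literature.Geometry.Lorentzian.InitialDataSet (𝓡 3) X → Prop := fun D ↦ (∃ 𝒟 : Literature.Geometry.Lorentzian.VacuumCauchyDevelopment D, 𝒟.IsMaximal) ∧ ∀ 𝒟 : Literature.Geometry.Lorentzian.VacuumCauchyDevelopment D, 𝒟.IsMaximal → Summit.FinalStateConjecture.HasCompleteNullInfinity 𝒟.toCauchyDevelopment ∧ ∃ (O : Set 𝒟.carrier) (d : Literature.Geometry.Lorentzian.FinalStateDecomposition 𝒟.toSpacetime O 2), (∀ i, Literature.Geometry.Lorentzian.Kerr.IsSubextremal (d.mass i) (d.spin i)) ∧ O = Summit.FinalStateConjecture.exteriorOf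 𝒟.toCauchyDevelopment d.charted ∧ Summit.FinalStateConjecture.RaysStayInClosure 𝒟.toCauchyDevelopment O ∧ Summit.FinalStateConjecture.HasExhaustiveCharts d ∧ Summit.FinalStateConjecture.IsFutureOriented d; let Disp : Literature.Geometry.Lorentzian.InitialDataSet (𝓡 3) X → Prop := fun D ↦ (∃ 𝒟 : Literature.Geometry.Lorentzian.VacuumCauchyDevelopment D, 𝒟.IsMaximal) ∧ ∀ 𝒟 : Literature.Geometry.Lorentzian.VacuumCauchyDevelopment D, 𝒟.IsMaximal → ∀ [𝒟.metric.HasLeviCivita], ¬ 𝒟.metric.IsFutureNullGeodesicallyIncomplete 𝒟.timeOrientation ∧ ¬ 𝒟.metric.IsFutureTimelikeGeodesicallyIncomplete 𝒟.timeOrientation; let Trap : Literature.Geometry.Lorentzian.InitialDataSet (𝓡 3) X → Prop := fun D ↦ (∃ 𝒟 : Literature.Geometry.Lorentzian.VacuumCauchyDevelopment D, 𝒟.IsMaximal) ∧ ∀ 𝒟 : Literature.Geometry.Lorentzian.VacuumCauchyDevelopment D, 𝒟.IsMaximal → ∀ [𝒟.metric.HasLeviCivita], ∃ f : Metric.sphere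 (0 : Literature.Geometry.Lorentzian.E3) 1 → 𝒟.carrier, Set.range f ⊆ 𝒟.metric.causalFuture 𝒟.timeOrientation (Set.range 𝒟.embed) ∧ 𝒟.metric.IsTrappedSurface (𝓡 2) 𝒟.timeOrientation f; ∀ d ∈ Literature.Geometry.Lorentzian.admissibleVacuumData X, ¬ P d → (¬ Disp d ∧ Trap d) → ∃ (e : Literature.Geometry.Lorentzian.AFEnd X) (F : EuclideanSpace ℝ (Fin 1) → Literature.Geometry.Lorentzian.InitialDataSet (𝓡 3) X), Literature.Geometry.Lorentzian.InitialDataSet.IsTameDataFamily e 1 F ∧ Literature.Geometry.Lorentzian.InitialDataSet.IsImmersedAtZero 1 F ∧ F 0 = d ∧ Injective F ∧ (∀ c, F c ∈ Literature.Geometry.Lorentzian.admissibleVacuumData X) ∧ ∀ c ≠ 0, P (F c)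

-- parent: TrappedExit · child (gen 2)
/--     item stmt-FinalStateConjecture-30550 · crux · rank 201 · open
    parent: TrappedExit · by planner
    why it might fail: a tame-open set of trapped-on-arrival admissible data whose censored exteriors never settle to sub-extremal Kerr (eternal non-Kerr hair, infinite fragmentation, horizons drifting to extremality) or which form locally naked singularities behind the horizon would be tame-STABLE exceptional
    sources: arXiv:0805.3880, doi:10.1103/PhysRevD.44.R3719, arXiv:0708.4252, arXiv:2211.15742, DafermosLuk2017, Klainerman2025
[REPAIRED gen-9 (lens-4 g9 «RegularTrapD»; critic c13 JUNK-NORMAL 06:54:06Z): the born text of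
InitiallyTrappedExit (stmt-FinalStateConjecture-27941) with ONE conjunct added inside the data-side
trapped-sphere predicate, right after `IsUnitNormal (𝓡 2) f ν 1 ∧` — «ν is C¹ along f»: ContMDiff (𝓡
2) (𝓡 3).tangent 1 (fun y ↦ TotalSpace.mk' E3 (f y) (ν y)) (the tree's own
secondFundamentalForm_apply hypothesis; spacetime-side NullNormalPair already demands it); nothing
else changed (python: R-text minus the conjunct == born text EXACT); supersedes 27941, which keeps
the rider JUNK-NORMAL(ν, acute) · split of TrappedExit (24764) stays EXACT + FREE: kernel split_iffR
: TrappedExit ↔ InitiallyTrappedExitR ∧ TrappedGaugeDescentR ∧ SliceHiddenTrappedExitR (two nested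
em on GTrapD′/TrapD′), bc7 CLEAN] [crux · gen-6 cut of TrappedExit
(stmt-FinalStateConjecture-24764), lens-4 g6 node TrappedGaugeSaturation («minimal counterexample
modulo the compactly supported slice gauge») · NEW RESIDUAL · WEAKER (lens kernel
initiallyTrappedExit_of_trappedExit; ⇏ parent: silent on LATE TRAPPERS — admissible data free of
trapped spheres whose developments trap later (Christodoulou 2008 short-pulse collapse; -/
@[route_item "route-FinalStateConjecture-RootDecompTrappedGauge"]
def InitiallyTrappedExitR : Prop :=
  ∀ (X : Type) [TopologicalSpace X] [ChartedSpace Literature.Geometry.Lorentzian.E3 X] [IsManifold (𝓡 3) ((⊤ : ℕ∞) : WithTop ℕ∞) X] [T2Space X] [SecondCountableTopology X] [ConnectedSpace X], let P : Literature.Geometry.Lorentzian.InitialDataSet (𝓡 3) X → Prop := fun D ↦ (∃ 𝒟 : Literature.Geometry.Lorentzian.VacuumCauchyDevelopment D, 𝒟.IsMaximal) ∧ ∀ 𝒟 : Literature.Geometry.Lorentzian.VacuumCauchyDevelopment D, 𝒟.IsMaximal → Summit.FinalStateConjecture.HasCompleteNullInfinity 𝒟.toCauchyDevelopment ∧ ∃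 (O : Set 𝒟.carrier) (d : Literature.Geometry.Lorentzian.FinalStateDecomposition 𝒟.toSpacetime O 2), (∀ i, Literature.Geometry.Lorentzian.Kerr.IsSubextremal (d.mass i) (d.spin i)) ∧ O = Summit.FinalStateConjecture.exteriorOf 𝒟.toCauchyDevelopment d.charted ∧ Summit.FinalStateConjecture.RaysStayInClosure 𝒟.toCauchyDevelopment O ∧ Summit.FinalStateConjecture.HasExhaustiveCharts d ∧ Summit.FinalStateConjecture.IsFutureOriented d; let Disp : Literature.Geometry.Lorentzian.InitialDataSet (𝓡 3) X → Prop := fun D ↦ (∃ 𝒟 : Literature.Geometry.Lorentzian.VacuumCauchyDevelopment D, 𝒟.IsMaximal) ∧ ∀ 𝒟 : Literature.Geometry.Lorentzian.VacuumCauchyDevelopment D, 𝒟.IsMaximal → ∀ [𝒟.metric.HasLeviCivita], ¬ 𝒟.metric.IsFutureNullGeodesicallyIncomplete 𝒟.timeOrientation ∧ ¬ 𝒟.metric.IsFutureTimelikeGeodesicallyIncomplete 𝒟.timeOrientation; let Trap : Literature.Geometry.Lorentzian.InitialDataSet (𝓡 3) X → Prop := fun D ↦ (∃ 𝒟 : Literature.Geometry.Lorentzian.VacuumCauchyDevelopment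 D, 𝒟.IsMaximal) ∧ ∀ 𝒟 : Literature.Geometry.Lorentzian.VacuumCauchyDevelopment D, 𝒟.IsMaximal → ∀ [𝒟.metric.HasLeviCivita], ∃ f : Metric.sphere (0 : Literature.Geometry.Lorentzian.E3) 1 → 𝒟.carrier, Set.range f ⊆ 𝒟.metric.causalFuture 𝒟.timeOrientation (Set.range 𝒟.embed) ∧ 𝒟.metric.IsTrappedSurface (𝓡 2) 𝒟.timeOrientation f; let TrapD : Literature.Geometry.Lorentzian.InitialDataSet (𝓡 3) X → Prop := fun D ↦ ∃ (hLC : D.metric.HasLeviCivita) (f : Metric.sphere (0 : Literature.Geometry.Lorentzian.E3) 1 → X) (ν : Literature.Geometry.Lorentzian.NormalField (𝓡 3) f) (hpb : Literature.Geometry.Lorentzian.PseudoRiemannianMetric.contMDiff_pullbackBilin (𝓡 3) X (𝓡 2) (Metric.sphere (0 : Literature.Geometry.Lorentzian.E3) 1) ((⊤ : ℕ∞) : WithTop ℕ∞)) (hf : (Literature.Geometry.Lorentzian.PseudoRiemannianMetric.ofRiemannian D.h).IsSpacelikeImmersion (𝓡 2) f), haveI : (Literature.Geometry.Lorentzian.PseudoRiemannianMetric.ofRiemannian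 D.h).HasLeviCivita := hLC; Manifold.IsSmoothEmbedding (𝓡 2) (𝓡 3) ((⊤ : ℕ∞) : WithTop ℕ∞) f ∧ (Literature.Geometry.Lorentzian.PseudoRiemannianMetric.ofRiemannian D.h).IsUnitNormal (𝓡 2) f ν 1 ∧ ContMDiff (𝓡 2) (𝓡 3).tangent 1 (fun y ↦ (Bundle.TotalSpace.mk' Literature.Geometry.Lorentzian.E3 (f y) (ν y) : TangentBundle (𝓡 3) X)) ∧ ∀ y, Literature.Geometry.Lorentzian.outerNullExpansionInData D.h D.k f hpb hf ν y < 0 ∧ Literature.Geometry.Lorentzian.innerNullExpansionInData D.h D.k f hpb hf ν y < 0; ∀ d ∈ Literature.Geometry.Lorentzian.admissibleVacuumData X, ¬ P d → (¬ Disp d ∧ Trap d) → TrapD d → ∃ (e : Literature.Geometry.Lorentzian.AFEnd X) (F : EuclideanSpace ℝ (Fin 1) → Literature.Geometry.Lorentzian.InitialDataSet (𝓡 3) X), Literature.Geometry.Lorentzian.InitialDataSet.IsTameDataFamily e 1 F ∧ Literature.Geometry.Lorentzian.InitialDataSet.IsImmersedAtZero 1 F ∧ F 0 = d ∧ Injective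 F ∧ (∀ c, F c ∈ Literature.Geometry.Lorentzian.admissibleVacuumData X) ∧ ∀ c ≠ 0, P (F c)

-- parent: TrappedExit · child (gen 2)
/--     item stmt-FinalStateConjecture-30551 · crux · rank 202 · open
    parent: TrappedExit · by planner
    why it might fail: only as typed: (i) the asymptotic clauses of P_Σ are anchored at ι(Σ) — slice-sensitivity would be an audit finding; (ii) DecompReslice needs chart time bounded on compacts; (iii) B4′ = Cauchy stability with C^∞ parameters, XL port; the junk-ν defect of 27942 (B3 false) is removed by the C¹ conjunct
    sources: doi:10.1007/BF01645389, HawkingEllis1973, doi:10.1007/BF00251584, Ringstrom2009, arXiv:gr-qc/0512095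
[REPAIRED gen-9 (lens-4 g9 «RegularTrapD»; critic c13 JUNK-NORMAL 06:54:06Z): the born text of
TrappedGaugeDescent (stmt-FinalStateConjecture-27942) with ONE conjunct added inside the data-side
trapped-sphere predicate, right after `IsUnitNormal (𝓡 2) f ν 1 ∧` — «ν is C¹ along f»: ContMDiff (𝓡
2) (𝓡 3).tangent 1 (fun y ↦ TotalSpace.mk' E3 (f y) (ν y)) (the tree's own
secondFundamentalForm_apply hypothesis; spacetime-side NullNormalPair already demands it); nothing
else changed (python: R-text minus the conjunct == born text EXACT); supersedes 27942, which keeps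
the rider JUNK-NORMAL(ν, acute) · split of TrappedExit (24764) stays EXACT + FREE: kernel split_iffR
: TrappedExit ↔ InitiallyTrappedExitR ∧ TrappedGaugeDescentR ∧ SliceHiddenTrappedExitR (two nested
em on GTrapD′/TrapD′), bc7 CLEAN] [crux · gen-6 cut of TrappedExit (stmt-24764), lens-4 g6 ·
formally WEAKER (S-implied: lens kernel trappedGaugeDescent_of_fsc / _of_trappedExit) · COUNTS ·
ATTACKABLE NOW (restored by the repair) = the REDUCTION THEOREM of the lens «tame cures descend
along the compactly supported slice gauge»: kernel (g9) trappedGaugeDescentR_of_kernelB0_split' :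
MGHDUnique → DecompReslice → ScriIso → DecompIso -/
@[route_item "route-FinalStateConjecture-RootDecompTrappedGauge"]
def TrappedGaugeDescentR : Prop :=
  ∀ (X : Type) [TopologicalSpace X] [ChartedSpace Literature.Geometry.Lorentzian.E3 X] [IsManifold (𝓡 3) ((⊤ : ℕ∞) : WithTop ℕ∞) X] [T2Space X] [SecondCountableTopology X] [ConnectedSpace X], let P : Literature.Geometry.Lorentzian.InitialDataSet (𝓡 3) X → Prop := fun D ↦ (∃ 𝒟 : Literature.Geometry.Lorentzian.VacuumCauchyDevelopment D, 𝒟.IsMaximal) ∧ ∀ 𝒟 : Literature.Geometry.Lorentzian.VacuumCauchyDevelopment D, 𝒟.IsMaximal → Summit.FinalStateConjecture.HasCompleteNullInfinity 𝒟.toCauchyDevelopment ∧ ∃ (O : Set 𝒟.carrier) (d : Literature.Geometry.Lorentzian.FinalStateDecomposition 𝒟.toSpacetime O 2), (∀ i, Literature.Geometry.Lorentzian.Kerr.IsSubextremal (d.mass i) (d.spin i)) ∧ O = Summit.FinalStateConjecture.exteriorOf 𝒟.toCauchyDevelopment d.charted ∧ Summit.FinalStateConjecture.RaysStayInClosure 𝒟.toCauchyDevelopment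 O ∧ Summit.FinalStateConjecture.HasExhaustiveCharts d ∧ Summit.FinalStateConjecture.IsFutureOriented d; let Disp : Literature.Geometry.Lorentzian.InitialDataSet (𝓡 3) X → Prop := fun D ↦ (∃ 𝒟 : Literature.Geometry.Lorentzian.VacuumCauchyDevelopment D, 𝒟.IsMaximal) ∧ ∀ 𝒟 : Literature.Geometry.Lorentzian.VacuumCauchyDevelopment D, 𝒟.IsMaximal → ∀ [𝒟.metric.HasLeviCivita], ¬ 𝒟.metric.IsFutureNullGeodesicallyIncomplete 𝒟.timeOrientation ∧ ¬ 𝒟.metric.IsFutureTimelikeGeodesicallyIncomplete 𝒟.timeOrientation; let Trap : Literature.Geometry.Lorentzian.InitialDataSet (𝓡 3) X → Prop := fun D ↦ (∃ 𝒟 : Literature.Geometry.Lorentzian.VacuumCauchyDevelopment D, 𝒟.IsMaximal) ∧ ∀ 𝒟 : Literature.Geometry.Lorentzian.VacuumCauchyDevelopment D, 𝒟.IsMaximal → ∀ [𝒟.metric.HasLeviCivita], ∃ f : Metric.sphere (0 : Literature.Geometry.Lorentzian.E3) 1 → 𝒟.carrier, Set.range f ⊆ 𝒟.metric.causalFuture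 𝒟.timeOrientation (Set.range 𝒟.embed) ∧ 𝒟.metric.IsTrappedSurface (𝓡 2) 𝒟.timeOrientation f; let TrapD : Literature.Geometry.Lorentzian.InitialDataSet (𝓡 3) X → Prop := fun D ↦ ∃ (hLC : D.metric.HasLeviCivita) (f : Metric.sphere (0 : Literature.Geometry.Lorentzian.E3) 1 → X) (ν : Literature.Geometry.Lorentzian.NormalField (𝓡 3) f) (hpb : Literature.Geometry.Lorentzian.PseudoRiemannianMetric.contMDiff_pullbackBilin (𝓡 3) X (𝓡 2) (Metric.sphere (0 : Literature.Geometry.Lorentzian.E3) 1) ((⊤ : ℕ∞) : WithTop ℕ∞)) (hf : (Literature.Geometry.Lorentzian.PseudoRiemannianMetric.ofRiemannian D.h).IsSpacelikeImmersion (𝓡 2) f), haveI : (Literature.Geometry.Lorentzian.PseudoRiemannianMetric.ofRiemannian D.h).HasLeviCivita := hLC; Manifold.IsSmoothEmbedding (𝓡 2) (𝓡 3) ((⊤ : ℕ∞) : WithTop ℕ∞) f ∧ (Literature.Geometry.Lorentzian.PseudoRiemannianMetric.ofRiemannian D.h).IsUnitNormal (𝓡 2) f ν 1 ∧ ContMDiff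 (𝓡 2) (𝓡 3).tangent 1 (fun y ↦ (Bundle.TotalSpace.mk' Literature.Geometry.Lorentzian.E3 (f y) (ν y) : TangentBundle (𝓡 3) X)) ∧ ∀ y, Literature.Geometry.Lorentzian.outerNullExpansionInData D.h D.k f hpb hf ν y < 0 ∧ Literature.Geometry.Lorentzian.innerNullExpansionInData D.h D.k f hpb hf ν y < 0; let Gauge : Literature.Geometry.Lorentzian.InitialDataSet (𝓡 3) X → Literature.Geometry.Lorentzian.InitialDataSet (𝓡 3) X → Prop := fun D D' ↦ ∃ (𝒟 : Literature.Geometry.Lorentzian.VacuumCauchyDevelopment D) (𝒟' : Literature.Geometry.Lorentzian.VacuumCauchyDevelopment D') (ψ : Diffeomorph (𝓡 4) (𝓡 4) 𝒟.carrier 𝒟'.carrier ((⊤ : ℕ∞) : WithTop ℕ∞)) (K : Set X), 𝒟.IsMaximal ∧ 𝒟'.IsMaximal ∧ 𝒟.metric.IsIsometry 𝒟'.metric.toPseudoRiemannianMetric ψ ∧ 𝒟.timeOrientation.PreservesTimeOrientation ψ 𝒟'.timeOrientation ∧ IsCompact K ∧ ∀ x, x ∉ K → ψ (𝒟.embed x)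 = 𝒟'.embed x; ∀ d ∈ Literature.Geometry.Lorentzian.admissibleVacuumData X, ¬ P d → (¬ Disp d ∧ Trap d) → ¬ TrapD d → (∃ d' ∈ Literature.Geometry.Lorentzian.admissibleVacuumData X, Gauge d d' ∧ TrapD d') → (∀ d' ∈ Literature.Geometry.Lorentzian.admissibleVacuumData X, Gauge d d' → ¬ P d' → (¬ Disp d' ∧ Trap d') → TrapD d' → ∃ (e : Literature.Geometry.Lorentzian.AFEnd X) (F : EuclideanSpace ℝ (Fin 1) → Literature.Geometry.Lorentzian.InitialDataSet (𝓡 3) X), Literature.Geometry.Lorentzian.InitialDataSet.IsTameDataFamily e 1 F ∧ Literature.Geometry.Lorentzian.InitialDataSet.IsImmersedAtZero 1 F ∧ F 0 = d' ∧ Injective F ∧ (∀ c, F c ∈ Literature.Geometry.Lorentzian.admissibleVacuumData X) ∧ ∀ c ≠ 0, P (F c)) → ∃ (e : Literature.Geometry.Lorentzian.AFEnd X) (F : EuclideanSpace ℝ (Fin 1) → Literature.Geometry.Lorentzian.InitialDataSet (𝓡 3) X), Literature.Geometry.Lorentzian.InitialDataSet.IsTameDataFamily e 1 F ∧ Literature.Geometry.Lorentzian.InitialDataSet.IsImmersedAtZero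 1 F ∧ F 0 = d ∧ Injective F ∧ (∀ c, F c ∈ Literature.Geometry.Lorentzian.admissibleVacuumData X) ∧ ∀ c ≠ 0, P (F c)

-- parent: TrappedExit · child (gen 2)
/--     item stmt-FinalStateConjecture-30552 · crux · rank 203 · open
    parent: TrappedExit · by planner
    why it might fail: only if hidden trapping is inhabited AND wild: developments whose closed trapped spheres are all non-achronal (no Cauchy slice through any of them) forming a tame-open exceptional set — no example is known; in Kruskal and in all collapse models trapped spheres lie on slices
    sources: doi:10.1103/PhysRevD.44.R3719, arXiv:2308.13950, arXiv:gr-qc/0512095, HawkingEllis1973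
[REPAIRED gen-9 (lens-4 g9 «RegularTrapD»; critic c13 JUNK-NORMAL 06:54:06Z): the born text of
SliceHiddenTrappedExit (stmt-FinalStateConjecture-27943) with ONE conjunct added inside the
data-side trapped-sphere predicate, right after `IsUnitNormal (𝓡 2) f ν 1 ∧` — «ν is C¹ along f»:
ContMDiff (𝓡 2) (𝓡 3).tangent 1 (fun y ↦ TotalSpace.mk' E3 (f y) (ν y)) (the tree's own
secondFundamentalForm_apply hypothesis; spacetime-side NullNormalPair already demands it); nothing
else changed (python: R-text minus the conjunct == born text EXACT); supersedes 27943, which keeps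
the rider JUNK-NORMAL(ν, acute) · split of TrappedExit (24764) stays EXACT + FREE: kernel split_iffR
: TrappedExit ↔ InitiallyTrappedExitR ∧ TrappedGaugeDescentR ∧ SliceHiddenTrappedExitR (two nested
em on GTrapD′/TrapD′), bc7 CLEAN] [crux · thin · gen-6 cut of TrappedExit (stmt-24764), lens-4 g6 ·
WEAKER (sub-cell; lens kernel sliceHiddenTrappedExit_of_trappedExit) · conjecturally VACUOUS: kernel
sliceHiddenTrappedExit_of_noHiddenTrapping : NoHiddenTrapping → SliceHiddenTrappedExit, where
NoHiddenTrapping (∀-data, PDE-free Lorentzian geometry, NOT S-implied ⇒ a stub, candidate aside)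
says that a development all of whose -/
@[route_item "route-FinalStateConjecture-RootDecompTrappedGauge"]
def SliceHiddenTrappedExitR : Prop :=
  ∀ (X : Type) [TopologicalSpace X] [ChartedSpace Literature.Geometry.Lorentzian.E3 X] [IsManifold (𝓡 3) ((⊤ : ℕ∞) : WithTop ℕ∞) X] [T2Space X] [SecondCountableTopology X] [ConnectedSpace X], let P : Literature.Geometry.Lorentzian.InitialDataSet (𝓡 3) X → Prop := fun D ↦ (∃ 𝒟 : Literature.Geometry.Lorentzian.VacuumCauchyDevelopment D, 𝒟.IsMaximal) ∧ ∀ 𝒟 : Literature.Geometry.Lorentzian.VacuumCauchyDevelopment D, 𝒟.IsMaximal → Summit.FinalStateConjecture.HasCompleteNullInfinity 𝒟.toCauchyDevelopment ∧ ∃ (O : Set 𝒟.carrier) (d : Literature.Geometry.Lorentzian.FinalStateDecomposition 𝒟.toSpacetime O 2), (∀ i, Literature.Geometry.Lorentzian.Kerr.IsSubextremal (d.mass i) (d.spin i)) ∧ O = Summit.FinalStateConjecture.exteriorOf 𝒟.toCauchyDevelopment d.charted ∧ Summit.FinalStateConjecture.RaysStayInClosure 𝒟.toCauchyDevelopment O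 ∧ Summit.FinalStateConjecture.HasExhaustiveCharts d ∧ Summit.FinalStateConjecture.IsFutureOriented d; let Disp : Literature.Geometry.Lorentzian.InitialDataSet (𝓡 3) X → Prop := fun D ↦ (∃ 𝒟 : Literature.Geometry.Lorentzian.VacuumCauchyDevelopment D, 𝒟.IsMaximal) ∧ ∀ 𝒟 : Literature.Geometry.Lorentzian.VacuumCauchyDevelopment D, 𝒟.IsMaximal → ∀ [𝒟.metric.HasLeviCivita], ¬ 𝒟.metric.IsFutureNullGeodesicallyIncomplete 𝒟.timeOrientation ∧ ¬ 𝒟.metric.IsFutureTimelikeGeodesicallyIncomplete 𝒟.timeOrientation; let Trap : Literature.Geometry.Lorentzian.InitialDataSet (𝓡 3) X → Prop := fun D ↦ (∃ 𝒟 : Literature.Geometry.Lorentzian.VacuumCauchyDevelopment D, 𝒟.IsMaximal) ∧ ∀ 𝒟 : Literature.Geometry.Lorentzian.VacuumCauchyDevelopment D, 𝒟.IsMaximal → ∀ [𝒟.metric.HasLeviCivita], ∃ f : Metric.sphere (0 : Literature.Geometry.Lorentzian.E3) 1 → 𝒟.carrier, Set.range f ⊆ 𝒟.metric.causalFuture 𝒟.timeOrientation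 (Set.range 𝒟.embed) ∧ 𝒟.metric.IsTrappedSurface (𝓡 2) 𝒟.timeOrientation f; let TrapD : Literature.Geometry.Lorentzian.InitialDataSet (𝓡 3) X → Prop := fun D ↦ ∃ (hLC : D.metric.HasLeviCivita) (f : Metric.sphere (0 : Literature.Geometry.Lorentzian.E3) 1 → X) (ν : Literature.Geometry.Lorentzian.NormalField (𝓡 3) f) (hpb : Literature.Geometry.Lorentzian.PseudoRiemannianMetric.contMDiff_pullbackBilin (𝓡 3) X (𝓡 2) (Metric.sphere (0 : Literature.Geometry.Lorentzian.E3) 1) ((⊤ : ℕ∞) : WithTop ℕ∞)) (hf : (Literature.Geometry.Lorentzian.PseudoRiemannianMetric.ofRiemannian D.h).IsSpacelikeImmersion (𝓡 2) f), haveI : (Literature.Geometry.Lorentzian.PseudoRiemannianMetric.ofRiemannian D.h).HasLeviCivita := hLC; Manifold.IsSmoothEmbedding (𝓡 2) (𝓡 3) ((⊤ : ℕ∞) : WithTop ℕ∞) f ∧ (Literature.Geometry.Lorentzian.PseudoRiemannianMetric.ofRiemannian D.h).IsUnitNormal (𝓡 2) f ν 1 ∧ ContMDiff (𝓡 2) (𝓡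 3).tangent 1 (fun y ↦ (Bundle.TotalSpace.mk' Literature.Geometry.Lorentzian.E3 (f y) (ν y) : TangentBundle (𝓡 3) X)) ∧ ∀ y, Literature.Geometry.Lorentzian.outerNullExpansionInData D.h D.k f hpb hf ν y < 0 ∧ Literature.Geometry.Lorentzian.innerNullExpansionInData D.h D.k f hpb hf ν y < 0; let Gauge : Literature.Geometry.Lorentzian.InitialDataSet (𝓡 3) X → Literature.Geometry.Lorentzian.InitialDataSet (𝓡 3) X → Prop := fun D D' ↦ ∃ (𝒟 : Literature.Geometry.Lorentzian.VacuumCauchyDevelopment D) (𝒟' : Literature.Geometry.Lorentzian.VacuumCauchyDevelopment D') (ψ : Diffeomorph (𝓡 4) (𝓡 4) 𝒟.carrier 𝒟'.carrier ((⊤ : ℕ∞) : WithTop ℕ∞)) (K : Set X), 𝒟.IsMaximal ∧ 𝒟'.IsMaximal ∧ 𝒟.metric.IsIsometry 𝒟'.metric.toPseudoRiemannianMetric ψ ∧ 𝒟.timeOrientation.PreservesTimeOrientation ψ 𝒟'.timeOrientation ∧ IsCompact K ∧ ∀ x, x ∉ K → ψ (𝒟.embed x) = 𝒟'.embed x; ∀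 d ∈ Literature.Geometry.Lorentzian.admissibleVacuumData X, ¬ P d → (¬ Disp d ∧ Trap d) → ¬ (∃ d' ∈ Literature.Geometry.Lorentzian.admissibleVacuumData X, Gauge d d' ∧ TrapD d') → ∃ (e : Literature.Geometry.Lorentzian.AFEnd X) (F : EuclideanSpace ℝ (Fin 1) → Literature.Geometry.Lorentzian.InitialDataSet (𝓡 3) X), Literature.Geometry.Lorentzian.InitialDataSet.IsTameDataFamily e 1 F ∧ Literature.Geometry.Lorentzian.InitialDataSet.IsImmersedAtZero 1 F ∧ F 0 = d ∧ Injective F ∧ (∀ c, F c ∈ Literature.Geometry.Lorentzian.admissibleVacuumData X) ∧ ∀ c ≠ 0, P (F c)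

-- parent: TrappedExit · glue (gen 2)
/--     item stmt-FinalStateConjecture-30553 · support · rank 204 · closed · proved by Summit.FinalStateConjecture.FinalStateConjecture.Theorems.RootDecompTrappedGaugeTrappedExitGlueR.trappedExitGlueR (prover)
    parent: TrappedExit · GLUE: children ⟹ parent · by planner
InitiallyTrappedExitR → TrappedGaugeDescentR → SliceHiddenTrappedExitR → TrappedExit -/
@[route_item "route-FinalStateConjecture-RootDecompTrappedGauge"]
def TrappedExitGlueR : Prop :=
  InitiallyTrappedExitR → TrappedGaugeDescentR → SliceHiddenTrappedExitR → TrappedExit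

-- `TrappedExitGlueR` holds: proved by `Summit.FinalStateConjecture.FinalStateConjecture.Theorems.RootDecompTrappedGaugeTrappedExitGlueR.trappedExitGlueR` (its module imports this route file, so no `_holds` link can be stated here).

/-- item stmt-FinalStateConjecture-24765 · crux · rank 3 · open · by planner
why it might fail: the extremal critical set B_crit could be thick in the tame topology (extremal thresholds accumulating on themselves along every tame line), or leaving the threshold could land in naked data; vacuum extremal formation itself is open (arXiv:2402.10190 p.12).
sources: arXiv:2402.10190, arXiv:2211.15742, arXiv:2304.08455
[crux] PIECE 𝓝∧P_w — ExtremalThresholdExit [WEAKER·thin — critic CLEARED 2026-08-30T01:39:13Z with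
retag: the printed Kehle–Unger exit family (arXiv:2402.10190 Thm 1, Einstein–Maxwell–Vlasov) is a
MODEL-ANALOGUE, not a rung; leaf IDEA-NEEDED; BARRIER placement: AretakisInstability concerns
settling ON the threshold, this piece only asks to LEAVE it along a tame curve — outside; the bet is
transversality of B_crit]. For every Σ and every admissible P_Σ-exceptional datum d of threshold
type (not dispersive, not trapped) which satisfies the WEAK property P_w (an MGHD exists; every MGHD
has complete 𝓘⁺ and a Kerr final state decomposition with all the Statement's clauses but only |aᵢ|
≤ Mᵢ — so d fails P_Σ only through an exactly extremal final hole), there are one end e and a tame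
immersed injective one-parameter family F of admissible data with F 0 = d whose members c ≠ 0
satisfy P_Σ. [difficulty: open-problem] -/
@[route_item "route-FinalStateConjecture-RootDecompTrappedGauge", crux]
def ExtremalThresholdExit : Prop :=
  ∀ (X : Type) [TopologicalSpace X] [ChartedSpace Literature.Geometry.Lorentzian.E3 X] [IsManifold (𝓡 3) ((⊤ : ℕ∞) : WithTop ℕ∞) X] [T2Space X] [SecondCountableTopology X] [ConnectedSpace X], let P : Literature.Geometry.Lorentzian.InitialDataSet (𝓡 3) X → Prop := fun D ↦ (∃ 𝒟 : Literature.Geometry.Lorentzian.VacuumCauchyDevelopment D, 𝒟.IsMaximal) ∧ ∀ 𝒟 : Literature.Geometry.Lorentzian.VacuumCauchyDevelopment D, 𝒟.IsMaximal → Summit.FinalStateConjecture.HasCompleteNullInfinity 𝒟.toCauchyDevelopment ∧ ∃ (O : Set 𝒟.carrier) (d : Literature.Geometry.Lorentzian.FinalStateDecomposition 𝒟.toSpacetime O 2), (∀ i, Literature.Geometry.Lorentzian.Kerr.IsSubextremal (d.mass i) (d.spin i)) ∧ O = Summit.FinalStateConjecture.exteriorOf 𝒟.toCauchyDevelopment d.charted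 ∧ Summit.FinalStateConjecture.RaysStayInClosure 𝒟.toCauchyDevelopment O ∧ Summit.FinalStateConjecture.HasExhaustiveCharts d ∧ Summit.FinalStateConjecture.IsFutureOriented d; let Pw : Literature.Geometry.Lorentzian.InitialDataSet (𝓡 3) X → Prop := fun D ↦ (∃ 𝒟 : Literature.Geometry.Lorentzian.VacuumCauchyDevelopment D, 𝒟.IsMaximal) ∧ ∀ 𝒟 : Literature.Geometry.Lorentzian.VacuumCauchyDevelopment D, 𝒟.IsMaximal → Summit.FinalStateConjecture.HasCompleteNullInfinity 𝒟.toCauchyDevelopment ∧ ∃ (O : Set 𝒟.carrier) (d : Literature.Geometry.Lorentzian.FinalStateDecomposition 𝒟.toSpacetime O 2), O = Summit.FinalStateConjecture.exteriorOf 𝒟.toCauchyDevelopment d.charted ∧ Summit.FinalStateConjecture.RaysStayInClosure 𝒟.toCauchyDevelopment O ∧ Summit.FinalStateConjecture.HasExhaustiveCharts d ∧ Summit.FinalStateConjecture.IsFutureOriented d; let Disp : Literature.Geometry.Lorentzian.InitialDataSet (𝓡 3) X → Prop := fun D ↦ (∃ 𝒟 : Literature.Geometry.Lorentzian.VacuumCauchyDevelopment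 D, 𝒟.IsMaximal) ∧ ∀ 𝒟 : Literature.Geometry.Lorentzian.VacuumCauchyDevelopment D, 𝒟.IsMaximal → ∀ [𝒟.metric.HasLeviCivita], ¬ 𝒟.metric.IsFutureNullGeodesicallyIncomplete 𝒟.timeOrientation ∧ ¬ 𝒟.metric.IsFutureTimelikeGeodesicallyIncomplete 𝒟.timeOrientation; let Trap : Literature.Geometry.Lorentzian.InitialDataSet (𝓡 3) X → Prop := fun D ↦ (∃ 𝒟 : Literature.Geometry.Lorentzian.VacuumCauchyDevelopment D, 𝒟.IsMaximal) ∧ ∀ 𝒟 : Literature.Geometry.Lorentzian.VacuumCauchyDevelopment D, 𝒟.IsMaximal → ∀ [𝒟.metric.HasLeviCivita], ∃ f : Metric.sphere (0 : Literature.Geometry.Lorentzian.E3) 1 → 𝒟.carrier, Set.range f ⊆ 𝒟.metric.causalFuture 𝒟.timeOrientation (Set.range 𝒟.embed) ∧ 𝒟.metric.IsTrappedSurface (𝓡 2) 𝒟.timeOrientation f; ∀ d ∈ Literature.Geometry.Lorentzian.admissibleVacuumData X, ¬ P d → (¬ Disp d ∧ ¬ Trap d ∧ Pw d) → ∃ (e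 : Literature.Geometry.Lorentzian.AFEnd X) (F : EuclideanSpace ℝ (Fin 1) → Literature.Geometry.Lorentzian.InitialDataSet (𝓡 3) X), Literature.Geometry.Lorentzian.InitialDataSet.IsTameDataFamily e 1 F ∧ Literature.Geometry.Lorentzian.InitialDataSet.IsImmersedAtZero 1 F ∧ F 0 = d ∧ Injective F ∧ (∀ c, F c ∈ Literature.Geometry.Lorentzian.admissibleVacuumData X) ∧ ∀ c ≠ 0, P (F c)

/-- item stmt-FinalStateConjecture-24766 · crux · rank 4 · open · by planner
why it might fail: a non-radiating vacuum breather or a complete development with curvature not decaying at i⁺ whose tame neighbours are also exceptional (an open set) refutes it; no-breather results hold only near 𝓘 (arXiv:1504.04592) or for decaying solutions (arXiv:2108.13379).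
sources: arXiv:2108.13379, arXiv:1504.04592, doi:10.1007/PL00001021
[crux] PIECE 𝓒 — DispersiveExit [WEAKER·thin — critic CLEARED 2026-08-30T01:39:13Z; implied outright
by the registered pointwise item stmt-FinalStateConjecture-17320
`NoParkingWithoutHorizon.CompleteSpacetimesDisperse` (lens kernel
`dispersiveExit_of_completeSpacetimesDisperse`; cited by name, not re-typed); leaf IDEA-NEEDED;
attackable-now sub-rung: stationary-complete ⇒ flat (Lichnerowicz–Anderson port); rung stmt-10029
NoVacuumBreathers]. For every Σ and every admissible P_Σ-exceptional datum d of dispersive type (an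
MGHD exists and every MGHD is future causally geodesically complete: no future null or timelike
geodesic incompleteness, stated under the metric's Levi-Civita instance), there are one end e and a
tame immersed injective one-parameter family F of admissible data with F 0 = d whose members c ≠ 0
satisfy P_Σ. [difficulty: open-problem] -/
@[route_item "route-FinalStateConjecture-RootDecompTrappedGauge", crux]
def DispersiveExit : Prop :=
  ∀ (X : Type) [TopologicalSpace X] [ChartedSpace Literature.Geometry.Lorentzian.E3 X] [IsManifold (𝓡 3) ((⊤ : ℕ∞) : WithTop ℕ∞) X] [T2Space X] [SecondCountableTopology X] [ConnectedSpace X], let P : Literature.Geometry.Lorentzian.InitialDataSet (𝓡 3) X → Prop := fun D ↦ (∃ 𝒟 : Literature.Geometry.Lorentzian.VacuumCauchyDevelopment D, 𝒟.IsMaximal) ∧ ∀ 𝒟 : Literature.Geometry.Lorentzian.VacuumCauchyDevelopment D, 𝒟.IsMaximal → Summit.FinalStateConjecture.HasCompleteNullInfinity 𝒟.toCauchyDevelopment ∧ ∃ (O : Set 𝒟.carrier) (d : Literature.Geometry.Lorentzian.FinalStateDecomposition 𝒟.toSpacetime O 2), (∀ i, Literature.Geometry.Lorentzian.Kerr.IsSubextremal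 (d.mass i) (d.spin i)) ∧ O = Summit.FinalStateConjecture.exteriorOf 𝒟.toCauchyDevelopment d.charted ∧ Summit.FinalStateConjecture.RaysStayInClosure 𝒟.toCauchyDevelopment O ∧ Summit.FinalStateConjecture.HasExhaustiveCharts d ∧ Summit.FinalStateConjecture.IsFutureOriented d; let Disp : Literature.Geometry.Lorentzian.InitialDataSet (𝓡 3) X → Prop := fun D ↦ (∃ 𝒟 : Literature.Geometry.Lorentzian.VacuumCauchyDevelopment D, 𝒟.IsMaximal) ∧ ∀ 𝒟 : Literature.Geometry.Lorentzian.VacuumCauchyDevelopment D, 𝒟.IsMaximal → ∀ [𝒟.metric.HasLeviCivita], ¬ 𝒟.metric.IsFutureNullGeodesicallyIncomplete 𝒟.timeOrientation ∧ ¬ 𝒟.metric.IsFutureTimelikeGeodesicallyIncomplete 𝒟.timeOrientation; ∀ d ∈ Literature.Geometry.Lorentzian.admissibleVacuumData X, ¬ P d → Disp d → ∃ (e : Literature.Geometry.Lorentzian.AFEnd X) (F : EuclideanSpace ℝ (Fin 1) → Literature.Geometry.Lorentzian.InitialDataSet (𝓡 3) X), Literature.Geometry.Lorentzian.InitialDataSet.IsTameDataFamily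 e 1 F ∧ Literature.Geometry.Lorentzian.InitialDataSet.IsImmersedAtZero 1 F ∧ F 0 = d ∧ Injective F ∧ (∀ c, F c ∈ Literature.Geometry.Lorentzian.admissibleVacuumData X) ∧ ∀ c ≠ 0, P (F c)

/-- item stmt-FinalStateConjecture-24767 · crux · rank 5 · open · by planner
why it might fail: a smooth-data analogue of the Singh–Zheng stability — a tame-open set of admissible vacuum data forming naked singularities (RSR arXiv:1912.08478 exteriors are fine-tuned, consistent so far).
sources: Christodoulou1999, arXiv:1912.08478, arXiv:2204.09891, arXiv:2605.16235, arXiv:0811.0354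
[crux] PIECE 𝓝∧¬P_w — NakedThresholdExit [WEAKER·COUNTS — critic CLEARED 2026-08-30T01:39:13Z; =
weak cosmic censorship on the untrapped incomplete sector in Christodoulou's own codimension form
(the all-cells version is the registered hard core stmt-FinalStateConjecture-17269, cited; this is
its cell restriction with cure target P_Σ); leaf IDEA-NEEDED; BARRIER: nakedSingularityInstability
is the MODEL exit family (Christodoulou1999 Thm 4.1, 2-plane of exits) = the generic form, outside
the genericity-blind class; functional-framework dependence (Singh–Zheng arXiv:2605.16235:
Hölder-stable naked singularities in the spherical scalar field) — the bet is that smooth tame data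
are on the unstable side]. For every Σ and every admissible P_Σ-exceptional datum d of threshold
type (not dispersive, not trapped) failing even the weak property P_w (no MGHD, or an MGHD with
incomplete 𝓘⁺, or censored but settling to no Kerr configuration with |aᵢ| ≤ Mᵢ), there are one end
e and a tame immersed injective one-parameter family F of admissible data with F 0 = d whose members
c ≠ 0 satisfy P_Σ. [difficulty: open-problem] -/
@[route_item "route-FinalStateConjecture-RootDecompTrappedGauge", crux]
def NakedThresholdExit : Prop :=
  ∀ (X : Type) [TopologicalSpace X] [ChartedSpace Literature.Geometry.Lorentzian.E3 X] [IsManifold (𝓡 3) ((⊤ : ℕ∞) : WithTop ℕ∞) X] [T2Space X] [SecondCountableTopology X] [ConnectedSpace X], let P : Literature.Geometry.Lorentzian.InitialDataSet (𝓡 3) X → Prop := fun D ↦ (∃ 𝒟 : Literature.Geometry.Lorentzian.VacuumCauchyDevelopment D, 𝒟.IsMaximal) ∧ ∀ 𝒟 : Literature.Geometry.Lorentzian.VacuumCauchyDevelopment D, 𝒟.IsMaximal → Summit.FinalStateConjecture.HasCompleteNullInfinity 𝒟.toCauchyDevelopment ∧ ∃ (O : Set 𝒟.carrier) (d : Literature.Geometry.Lorentzian.FinalStateDecomposition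 𝒟.toSpacetime O 2), (∀ i, Literature.Geometry.Lorentzian.Kerr.IsSubextremal (d.mass i) (d.spin i)) ∧ O = Summit.FinalStateConjecture.exteriorOf 𝒟.toCauchyDevelopment d.charted ∧ Summit.FinalStateConjecture.RaysStayInClosure 𝒟.toCauchyDevelopment O ∧ Summit.FinalStateConjecture.HasExhaustiveCharts d ∧ Summit.FinalStateConjecture.IsFutureOriented d; let Pw : Literature.Geometry.Lorentzian.InitialDataSet (𝓡 3) X → Prop := fun D ↦ (∃ 𝒟 : Literature.Geometry.Lorentzian.VacuumCauchyDevelopment D, 𝒟.IsMaximal) ∧ ∀ 𝒟 : Literature.Geometry.Lorentzian.VacuumCauchyDevelopment D, 𝒟.IsMaximal → Summit.FinalStateConjecture.HasCompleteNullInfinity 𝒟.toCauchyDevelopment ∧ ∃ (O : Set 𝒟.carrier) (d : Literature.Geometry.Lorentzian.FinalStateDecomposition 𝒟.toSpacetime O 2), O = Summit.FinalStateConjecture.exteriorOf 𝒟.toCauchyDevelopment d.charted ∧ Summit.FinalStateConjecture.RaysStayInClosure 𝒟.toCauchyDevelopment O ∧ Summit.FinalStateConjecture.HasExhaustiveCharts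 d ∧ Summit.FinalStateConjecture.IsFutureOriented d; let Disp : Literature.Geometry.Lorentzian.InitialDataSet (𝓡 3) X → Prop := fun D ↦ (∃ 𝒟 : Literature.Geometry.Lorentzian.VacuumCauchyDevelopment D, 𝒟.IsMaximal) ∧ ∀ 𝒟 : Literature.Geometry.Lorentzian.VacuumCauchyDevelopment D, 𝒟.IsMaximal → ∀ [𝒟.metric.HasLeviCivita], ¬ 𝒟.metric.IsFutureNullGeodesicallyIncomplete 𝒟.timeOrientation ∧ ¬ 𝒟.metric.IsFutureTimelikeGeodesicallyIncomplete 𝒟.timeOrientation; let Trap : Literature.Geometry.Lorentzian.InitialDataSet (𝓡 3) X → Prop := fun D ↦ (∃ 𝒟 : Literature.Geometry.Lorentzian.VacuumCauchyDevelopment D, 𝒟.IsMaximal) ∧ ∀ 𝒟 : Literature.Geometry.Lorentzian.VacuumCauchyDevelopment D, 𝒟.IsMaximal → ∀ [𝒟.metric.HasLeviCivita], ∃ f : Metric.sphere (0 : Literature.Geometry.Lorentzian.E3) 1 → 𝒟.carrier, Set.range f ⊆ 𝒟.metric.causalFuture 𝒟.timeOrientation (Set.range 𝒟.embed) ∧ 𝒟.metric.IsTrappedSurface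 (𝓡 2) 𝒟.timeOrientation f; ∀ d ∈ Literature.Geometry.Lorentzian.admissibleVacuumData X, ¬ P d → (¬ Disp d ∧ ¬ Trap d ∧ ¬ Pw d) → ∃ (e : Literature.Geometry.Lorentzian.AFEnd X) (F : EuclideanSpace ℝ (Fin 1) → Literature.Geometry.Lorentzian.InitialDataSet (𝓡 3) X), Literature.Geometry.Lorentzian.InitialDataSet.IsTameDataFamily e 1 F ∧ Literature.Geometry.Lorentzian.InitialDataSet.IsImmersedAtZero 1 F ∧ F 0 = d ∧ Injective F ∧ (∀ c, F c ∈ Literature.Geometry.Lorentzian.admissibleVacuumData X) ∧ ∀ c ≠ 0, P (F c)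

/-- item stmt-FinalStateConjecture-24768 · assembly · rank 1 · open · by planner
sources: doi:10.1103/PhysRevLett.14.57
[assembly] DispersiveExit → TrappedExit → ExtremalThresholdExit → NakedThresholdExit → the final
state conjecture as typed. -/
@[route_item "route-FinalStateConjecture-RootDecompTrappedGauge"]
def Assembly : Prop :=
  DispersiveExit → TrappedExit → ExtremalThresholdExit → NakedThresholdExit → FinalStateConjecture

/-! D-0027 §2.1 — DECIDING THEOREM (planner-authored via `route open/edit --closes-file`; by planner-decomp-fsc-writer-1-g0-0 2026-08-30T04:34:57Z):
its hypotheses are this route's items and its conclusion the sub-problem Statement (glue_lint), and it elaborates with this file. -/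

@[closes "route-FinalStateConjecture-RootDecompTrappedGauge"] theorem closes (h₁ : DispersiveExit) (h₂ : TrappedExit) (h₃ : ExtremalThresholdExit) (h₄ : NakedThresholdExit) : FinalStateConjecture := by
  intro X _ _ _ _ _ _ d hd
  suffices h : ∃ (e : Literature.Geometry.Lorentzian.AFEnd X) (F : EuclideanSpace ℝ (Fin 1) → Literature.Geometry.Lorentzian.InitialDataSet (𝓡 3) X), Literature.Geometry.Lorentzian.InitialDataSet.IsTameDataFamily e 1 F ∧ Literature.Geometry.Lorentzian.InitialDataSet.IsImmersedAtZero 1 F ∧ F 0 = d ∧ Injective F ∧ (∀ c, F c ∈ Literature.Geometry.Lorentzian.admissibleVacuumData X) ∧ ∀ c ≠ 0, ((∃ 𝒟 : Literature.Geometry.Lorentzian.VacuumCauchyDevelopment (F c), 𝒟.IsMaximal) ∧ ∀ 𝒟 : Literature.Geometry.Lorentzian.VacuumCauchyDevelopment (F c), 𝒟.IsMaximal → Summit.FinalStateConjecture.HasCompleteNullInfinity 𝒟.toCauchyDevelopment ∧ ∃ (O : Set 𝒟.carrier) (d : Literature.Geometry.Lorentzian.FinalStateDecomposition 𝒟.toSpacetime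 O 2), (∀ i, Literature.Geometry.Lorentzian.Kerr.IsSubextremal (d.mass i) (d.spin i)) ∧ O = Summit.FinalStateConjecture.exteriorOf 𝒟.toCauchyDevelopment d.charted ∧ Summit.FinalStateConjecture.RaysStayInClosure 𝒟.toCauchyDevelopment O ∧ Summit.FinalStateConjecture.HasExhaustiveCharts d ∧ Summit.FinalStateConjecture.IsFutureOriented d) by
    obtain ⟨e, F, h1, h2, h3, h4, h5, h6⟩ := h
    exact ⟨e, F, h1, h2, h3, h4, h5, fun c hc hmem ↦ hmem.2 (h6 c hc)⟩
  by_cases hD : (∃ 𝒟 : Literature.Geometry.Lorentzian.VacuumCauchyDevelopment d, 𝒟.IsMaximal) ∧ ∀ 𝒟 : Literature.Geometry.Lorentzian.VacuumCauchyDevelopment d, 𝒟.IsMaximal → ∀ [𝒟.metric.HasLeviCivita], ¬ 𝒟.metric.IsFutureNullGeodesicallyIncomplete 𝒟.timeOrientation ∧ ¬ 𝒟.metric.IsFutureTimelikeGeodesicallyIncomplete 𝒟.timeOrientation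
  · exact h₁ X d hd.1 hd.2 hD
  by_cases hT : (∃ 𝒟 : Literature.Geometry.Lorentzian.VacuumCauchyDevelopment d, 𝒟.IsMaximal) ∧ ∀ 𝒟 : Literature.Geometry.Lorentzian.VacuumCauchyDevelopment d, 𝒟.IsMaximal → ∀ [𝒟.metric.HasLeviCivita], ∃ f : Metric.sphere (0 : Literature.Geometry.Lorentzian.E3) 1 → 𝒟.carrier, Set.range f ⊆ 𝒟.metric.causalFuture 𝒟.timeOrientation (Set.range 𝒟.embed) ∧ 𝒟.metric.IsTrappedSurface (𝓡 2) 𝒟.timeOrientation f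
  · exact h₂ X d hd.1 hd.2 ⟨hD, hT⟩
  by_cases hW : (∃ 𝒟 : Literature.Geometry.Lorentzian.VacuumCauchyDevelopment d, 𝒟.IsMaximal) ∧ ∀ 𝒟 : Literature.Geometry.Lorentzian.VacuumCauchyDevelopment d, 𝒟.IsMaximal → Summit.FinalStateConjecture.HasCompleteNullInfinity 𝒟.toCauchyDevelopment ∧ ∃ (O : Set 𝒟.carrier) (d : Literature.Geometry.Lorentzian.FinalStateDecomposition 𝒟.toSpacetime O 2), O = Summit.FinalStateConjecture.exteriorOf 𝒟.toCauchyDevelopment d.charted ∧ Summit.FinalStateConjecture.RaysStayInClosure 𝒟.toCauchyDevelopment O ∧ Summit.FinalStateConjecture.HasExhaustiveCharts d ∧ Summit.FinalStateConjecture.IsFutureOriented d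
  · exact h₃ X d hd.1 hd.2 ⟨hD, hT, hW⟩
  · exact h₄ X d hd.1 hd.2 ⟨hD, hT, hW⟩

end Summit.FinalStateConjecture.FinalStateConjecture.Theses.RootDecompTrappedGauge
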